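/-
Copyright (c) 2026. All rights reserved.
Released under Apache 2.0 license as described in the file LICENSE.
Authors: abc-iut cell, prover seat abc-iut-L4-t12 (gen 8).
-/
import Literature.AnabelianGeometry.AbsoluteAnabelian.ArchimedeanHolFieldFunctorGeometricOverIdRigidTripod
import Literature.Analysis.Complex.PuncturedPlaneAutomorphismGroup
import HarnessLib

/-!
# [AbsTopIII] Prop 4.2 (i), geometric column: `Aut(ℂ ∖ F)` in `HolRS` is finite

PROOF-ONLY junction file (abc-iut cell, campaign-L item R1.2 of the `EA` column of [AbsTopIII]
Prop 4.2 / Cor 4.5; classical).  The automorphism group of a sphere with at least three punctures is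
finite (J. B. Conway, *Functions of One Complex Variable I*, Ch. V Thm. 1.21 with Ch. III §3; the
tree's `Literature.Analysis.Complex.PuncturedPlane.finite_holAut`), read through the junction
`HolRS.exists_mem_holAut_of_iso` for the object `planeComplFinite F hF` of abc-iut-L4-t14's `HolRS`:

* `HolRS.finite_iso_planeComplFinite` — for `F ⊆ ℂ` finite with two distinct points, the type of
  automorphisms `planeComplFinite F hF ≅ planeComplFinite F hF` in `HolRS` is finite.

(For the hyperbolic curves `ℙ¹ ∖ (F ∪ {∞})` of the abc-iut cell this is the finiteness of `Aut` that
print uses silently, e.g. in [AbsTopIII] §2; model level; nothing here bears on [IUTchIII] Cor. 3.12;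
support library, not a node.)  No definitions.

## References

* S. Mochizuki, *Topics in Absolute Anabelian Geometry III*, kurims ms, Prop 4.2 (i) p.106. [MochizukiAbsTopIII2015]
* J. B. Conway, *Functions of One Complex Variable I*, GTM 11 (1978), Ch. V Thm. 1.21. [Conway1978]
-/

noncomputable section

open CategoryTheory Set Topology TopologicalSpace
open Literature.Analysis.Complex

namespace Literature.AnabelianGeometry.AbsoluteAnabelian

namespace HolRS

variable {F : Set ℂ} (hF : F.Finite)

/-- **`Aut_{HolRS}(ℂ ∖ F)` is finite** for `F` finite with two distinct points: the junction
`a ↦ (its underlying element of holAut U)` is injective (a morphism of `HolRS` is determined by its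
underlying map) into the finite set `Aut^hol(ℂ ∖ F)` (`PuncturedPlane.finite_holAut`).
[cite: Conway1978, Ch. V Thm. 1.21] [cite: MochizukiAbsTopIII2015, Proposition 4.2 (i) p.106] -/
theorem finite_iso_planeComplFinite {p₁ p₂ : ℂ} (hp₁ : p₁ ∈ F) (hp₂ : p₂ ∈ F) (hp : p₁ ≠ p₂) :
    Finite (planeComplFinite F hF ≅ planeComplFinite F hF) := by
  classical
  set U : Opens ℂ := ⟨Fᶜ, hF.isClosed.isOpen_compl⟩ with hUdef
  have hU : (U : Set ℂ) = Fᶜ := rfl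
  haveI : Finite ↥(holAut U : Set (U ≃ₜ U)) :=
    (PuncturedPlane.finite_holAut hU hF hp₁ hp₂ hp).to_subtype
  -- the junction `Aut_{HolRS} → Aut^hol`, a choice of the underlying homeomorphism
  have hex : ∀ a : planeComplFinite F hF ≅ planeComplFinite F hF,
      ∃ φ : ↥(holAut U : Set (U ≃ₜ U)), ⇑φ.1 = a.hom.toFun := fun a => by
    obtain ⟨φ, hφ, hφa, -⟩ := exists_mem_holAut_of_iso U (isConnected_compl_finite hF) a
    exact ⟨⟨φ, hφ⟩, hφa⟩
  choose ι hι using hex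
  refine Finite.of_injective ι fun a b hab => ?_
  have h : a.hom.toFun = b.hom.toFun := by rw [← hι a, ← hι b, hab]
  exact Iso.ext (hom_ext h)

end HolRS

end Literature.AnabelianGeometry.AbsoluteAnabelian
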